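import Summits.Ventures.HSemireg.WedgeHankelRecurrenceGaussChebyshevCHalfAngle

/-!
# Venture HSemireg — **THE MONIC SCHUR TABLE IN CHARACTERISTIC `p`: `2 S_p = X^p + X (X² − 4)^{(p−1)∕2}`, `2 S_{p−2} = X (X² − 4)^{(p−1)∕2} − X^p`, `2 C_{p+1} = X^{p+1} + (X² − 4)^{(p+1)∕2}`,
# `2 C_{p−1} = X^{p+1} − (X² − 4)^{(p+1)∕2}`, `S_{2p−1} = X^p (X² − 4)^{(p−1)∕2}`** in every commutative ring of odd prime characteristic `p`, and **`C_{2p} = X^{2p} − 2`** in every prime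
# characteristic — the Vieta-normalised companion of N475, from `C_p = X^p` (N473) and `S_{p−1} = (X² − 4)^{(p−1)∕2}` (N484); evaluated at `x ∈ 𝔽_p` these are the polynomial identities behind
# the rank-of-apparition congruences `U_{p∓1}(P,1) ≡ 0` according as `(P² − 4 ∕ p) = ±1` (integer forms: `Literature.NumberTheory.LucasSequences.CongruenceRelations`, not restated)

HONEST FRAMING. Part of the Lean index of the computation cell `pub-hsemireg` (seat p10 gen 48, Sunday typer «UNIFORM-IN-n»).  Polynomial algebra in characteristic `p` only; no variety, no cohomology
theory, no sheaf, no Ext group and no semiregularity map is constructed here; nothing here says that HC / HC_CM / HC_AV holds; no Literature fact (unproved `Prop`) is declared or used.  Custodian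
versions as in `WedgeHankelSiegelIdeal` (1/3).
SOURCES (cited).  I. Schur, *Arithmetisches über die Tschebyscheffschen Polynome*, Ges. Abh. III (1973) 422–453, §1; R. Lidl, G. L. Mullen, G. Turnwald, *Dickson Polynomials* (1993), Ch. 2; P. Ribenboim,
*My Numbers, My Friends* (2000), Ch. 1 §IV.
PROOF TYPED HERE.  Mathlib `C_eq_S_sub_X_mul_S`, `S_add_two`, `C_add_two`, `C_mul_C`, `C_zero`, `S_neg_one`; N473 `chebyshevC_eq_X_pow_charP`; N481 `chebyshevC_mul_S`; N484 `chebyshevS_pred_eq_pow_charP`.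
DEDUP DISCLOSURE (`rg -n 'two_mul_chebyshevS_prime|two_mul_chebyshevS_prime_sub_two|two_mul_chebyshevC_succ_prime|two_mul_chebyshevC_pred_prime|chebyshevS_two_mul_prime_pred|chebyshevC_two_mul_prime'
Summits Literature HarnessLib`, 2026-09-04): N475 (the `T ∕ U` table); 0 hits for the 6 names below.

WHAT IS IN THE TREE.  N473, N475, N481, N484.
THIS FILE (namespace `Summit.Ventures.HSemireg.Wedge.HankelOuter` continued; CHAINED on N485; 0 definitions):
* §1251 **`two_mul_chebyshevS_prime_charP`**, **`two_mul_chebyshevS_prime_sub_two_charP`**, **`two_mul_chebyshevC_pred_prime_charP`**, **`two_mul_chebyshevC_succ_prime_charP`**,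
  **`chebyshevS_two_mul_prime_pred_charP`**, `chebyshevC_two_mul_prime_charP`.
CAVEATS.  `p` odd except in the last statement; the factor `2` is kept on the left (it is a unit, but no inverse is introduced).  Nothing Ext-side.  New names only.
-/

open Module Polynomial
open scoped Matrix Polynomial

namespace Summit.Ventures.HSemireg.Wedge.HankelOuter

/-! ## §1251. The monic Schur table in characteristic `p` -/

/-- **`2 S_p = X^p + X (X² − 4)^{(p−1)∕2}`** in every commutative ring of odd prime characteristic `p`. [Schur 1931 §1 (Vieta normalisation); this file, §1251] -/
theorem two_mul_chebyshevS_prime_charP (R : Type*) [CommRing R] (p : ℕ) [Fact p.Prime] [CharP R p] (hp2 : p ≠ 2) :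
    2 * Polynomial.Chebyshev.S R (p : ℤ) = Polynomial.X ^ p + Polynomial.X * (Polynomial.X ^ 2 - 4) ^ ((p - 1) / 2) := by
  have h := Polynomial.Chebyshev.C_eq_S_sub_X_mul_S R (p : ℤ)
  rw [chebyshevC_eq_X_pow_charP R p, chebyshevS_pred_eq_pow_charP R p hp2] at h
  linear_combination (-1 : R[X]) * h

/-- **`2 S_{p−2} = X (X² − 4)^{(p−1)∕2} − X^p`** in every commutative ring of odd prime characteristic `p`. [Schur 1931 §1 (Vieta normalisation); this file, §1251] -/
theorem two_mul_chebyshevS_prime_sub_two_charP (R : Type*) [CommRing R] (p : ℕ) [Fact p.Prime] [CharP R p] (hp2 : p ≠ 2) :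
    2 * Polynomial.Chebyshev.S R ((p : ℤ) - 2) = Polynomial.X * (Polynomial.X ^ 2 - 4) ^ ((p - 1) / 2) - Polynomial.X ^ p := by
  have h := Polynomial.Chebyshev.S_add_two R ((p : ℤ) - 2)
  rw [sub_add_cancel, show (p : ℤ) - 2 + 1 = (p : ℤ) - 1 by ring, chebyshevS_pred_eq_pow_charP R p hp2] at h
  have h2 := two_mul_chebyshevS_prime_charP R p hp2
  linear_combination 2 * h - h2

/-- **`2 C_{p−1} = X^{p+1} − (X² − 4)^{(p+1)∕2}`** in every commutative ring of odd prime characteristic `p`. [Schur 1931 §1 (Vieta normalisation); this file, §1251] -/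
theorem two_mul_chebyshevC_pred_prime_charP (R : Type*) [CommRing R] (p : ℕ) [hp : Fact p.Prime] [CharP R p] (hp2 : p ≠ 2) :
    2 * Polynomial.Chebyshev.C R ((p : ℤ) - 1) = Polynomial.X ^ (p + 1) - (Polynomial.X ^ 2 - 4) ^ ((p + 1) / 2) := by
  have hq : (p + 1) / 2 = (p - 1) / 2 + 1 := by
    have h1 := hp.out.one_le; omega
  have h := Polynomial.Chebyshev.C_eq_S_sub_X_mul_S R ((p : ℤ) - 1)
  rw [show (p : ℤ) - 1 - 1 = (p : ℤ) - 2 by ring, chebyshevS_pred_eq_pow_charP R p hp2] at h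
  have h2 := two_mul_chebyshevS_prime_sub_two_charP R p hp2
  rw [hq, pow_succ, pow_succ]
  linear_combination 2 * h - (Polynomial.X : R[X]) * h2

/-- **`2 C_{p+1} = X^{p+1} + (X² − 4)^{(p+1)∕2}`** in every commutative ring of odd prime characteristic `p`. [Schur 1931 §1 (Vieta normalisation); this file, §1251] -/
theorem two_mul_chebyshevC_succ_prime_charP (R : Type*) [CommRing R] (p : ℕ) [Fact p.Prime] [CharP R p] (hp2 : p ≠ 2) :
    2 * Polynomial.Chebyshev.C R ((p : ℤ) + 1) = Polynomial.X ^ (p + 1) + (Polynomial.X ^ 2 - 4) ^ ((p + 1) / 2) := by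
  have h := Polynomial.Chebyshev.C_add_two R ((p : ℤ) - 1)
  rw [show (p : ℤ) - 1 + 2 = (p : ℤ) + 1 by ring, sub_add_cancel, chebyshevC_eq_X_pow_charP R p] at h
  have h2 := two_mul_chebyshevC_pred_prime_charP R p hp2
  rw [pow_succ] at h2 ⊢
  linear_combination 2 * h - h2

/-- **`S_{2p−1} = X^p (X² − 4)^{(p−1)∕2}`** in every commutative ring of odd prime characteristic `p` (`S_{2n−1} = C_n S_{n−1}`). [this file, §1251] -/
theorem chebyshevS_two_mul_prime_pred_charP (R : Type*) [CommRing R] (p : ℕ) [Fact p.Prime] [CharP R p] (hp2 : p ≠ 2) :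
    Polynomial.Chebyshev.S R (2 * (p : ℤ) - 1) = Polynomial.X ^ p * (Polynomial.X ^ 2 - 4) ^ ((p - 1) / 2) := by
  have h := chebyshevC_mul_S (R := R) (p : ℤ) ((p : ℤ) - 1)
  rw [show (p : ℤ) - 1 + (p : ℤ) = 2 * (p : ℤ) - 1 by ring, show (p : ℤ) - 1 - (p : ℤ) = -1 by ring, Polynomial.Chebyshev.S_neg_one, add_zero,
    chebyshevC_eq_X_pow_charP R p, chebyshevS_pred_eq_pow_charP R p hp2] at h
  rw [← h]

/-- **`C_{2p} = X^{2p} − 2`** in every commutative ring of prime characteristic `p` (`C_{2n} = C_n² − 2`). [this file, §1251] -/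
theorem chebyshevC_two_mul_prime_charP (R : Type*) [CommRing R] (p : ℕ) [Fact p.Prime] [CharP R p] :
    Polynomial.Chebyshev.C R (2 * (p : ℤ)) = Polynomial.X ^ (2 * p) - 2 := by
  have h := Polynomial.Chebyshev.C_mul_C R (p : ℤ) (p : ℤ)
  rw [show (p : ℤ) + (p : ℤ) = 2 * (p : ℤ) by ring, sub_self, Polynomial.Chebyshev.C_zero, chebyshevC_eq_X_pow_charP R p] at h
  rw [pow_mul']
  linear_combination (-1 : R[X]) * h

end Summit.Ventures.HSemireg.Wedge.HankelOuter
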